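import Literature.Computability.MetaComplexity.HeuristicClasses
import Literature.Computability.Complexity.PairProjections
import HarnessLib

/-!
# Heuristic polynomial-time reducibility is reflexive (Bogdanov–Trevisan 2006, §3.1) — the proof

Computability/MetaComplexity support file (theorem-only) containing the discharge
`Literature.Computability.MetaComplexity.DistProblem.PolyTimeReducible.refl_holds` of the named
fact `Literature.Computability.MetaComplexity.DistProblem.PolyTimeReducible.refl`
(`MetaComplexity/HeuristicClasses`): every distributional problem `Q = (L, D)` reduces to itself
under heuristic polynomial-time reductions (`Q ≤_{AvgP} Q`, Bogdanov–Trevisan Def. 3.1).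

The proof is the one recorded with the fact («`f(x; n) = x`, `m = X`, `p = 1`»): the reduction is
the first projection `⟨x, 1ⁿ⟩ ↦ x`, polynomial time by the tree's pair-projection transducer
(`Literature.Computability.Complexity.boolUnpairFst_mem_FP`, `Complexity/PairProjections`, read
through the input encoding `paramEnc (x, n) = boolPair x 1ⁿ` — same machine, reindexed input);
it is correct on the support trivially, and `D` dominates itself along it with domination
factor `p = 1` and parameter map `m = X`, since `Pr_{x ∼ Dₙ}[x = y] = Dₙ(y)`
(`PMF.toOuterMeasure_apply_singleton`).

This is NOT one of the Karp/promise reflexivity facts sharing the short name `refl`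
(`PolyTimeReducible.refl`, `PromiseProblem.PolyTimeReducible.refl`, …, all already proved in
their own files): the declaration discharged here is the distributional one, over
`DistProblem` with the domination clause.

No new definition, no new named fact.

## References

* A. Bogdanov, L. Trevisan, *Average-case complexity*, Found. Trends Theor. Comput. Sci. 2
  (2006), no. 1, §3.1 (Def. 3.1: heuristic polynomial-time reductions; the remark after it).
  [BogdanovTrevisan2006]
-/

namespace Literature.Computability.MetaComplexity

open _root_.Computability Complexity
open scoped ENNReal

/-- The identity reduction `f(x; n) = x` is polynomial-time computable from the parametrised
input `⟨x, 1ⁿ⟩` (`paramEnc`): it is the first pair projection, computed by the tree's transducer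
`boolUnpairFst_mem_FP` on the word `boolPair x 1ⁿ` (same machine and time bound, the input merely
reindexed along `paramEnc`). [cite: BogdanovTrevisan2006, §3.1] -/
theorem polyTimeComputable_paramEnc_fst :
    PolyTimeComputable paramEnc (id : List Bool → List Bool)
      (Function.uncurry fun (x : List Bool) (_ : ℕ) => x) := by
  obtain ⟨p, M, hM⟩ := boolUnpairFst_mem_FP
  refine ⟨p, M, fun q => ?_⟩
  have h := hM (paramEnc q)
  simp only [id, paramEnc, boolUnpair_boolPair] at h
  simpa [paramEnc, Function.uncurry] using h

/-- Every ensemble dominates itself along the identity map, with domination factor `p = 1` and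
parameter map `m = X`: `Pr_{x ∼ Dₙ}[x = y] = Dₙ(y) ≤ 1 · D_{X(n)}(y)`.
[cite: BogdanovTrevisan2006, Def. 3.1 (ii] -/
theorem isDominatedVia_self (D : Ensemble) : IsDominatedVia D (fun x _ => x) D := by
  refine ⟨1, Polynomial.X, fun n y => ?_⟩
  have hset : {x : List Bool | x = y} = {y} := by
    ext x
    simp
  rw [hset, PMF.toOuterMeasure_apply_singleton, Polynomial.eval_one, Polynomial.eval_X,
    Nat.cast_one, one_mul]

/-- **Discharge of `DistProblem.PolyTimeReducible.refl`**: heuristic polynomial-time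
reducibility is reflexive — the reduction `f(x; n) = x` (`polyTimeComputable_paramEnc_fst`),
correct on the support by `Iff.rfl`, with the self-domination `isDominatedVia_self`
(`m = X`, `p = 1`). [cite: BogdanovTrevisan2006, §3.1] -/
theorem DistProblem.PolyTimeReducible.refl_holds : DistProblem.PolyTimeReducible.refl := by
  intro Q
  exact ⟨fun x _ => x, polyTimeComputable_paramEnc_fst, fun n x _ => Iff.rfl,
    isDominatedVia_self Q.dist⟩

/-- Usable form of `DistProblem.PolyTimeReducible.refl_holds`: `Q ≤_{AvgP} Q`.
[cite: BogdanovTrevisan2006, §3.1] -/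
theorem DistProblem.polyTimeReducible_refl (Q : DistProblem) : Q.PolyTimeReducible Q :=
  DistProblem.PolyTimeReducible.refl_holds Q

end Literature.Computability.MetaComplexity
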